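import Literature.MathematicalPhysics.QuantumManyBody.PeriodicMaxFormBound
import HarnessLib

/-!
# Ground states of the maximal form of the periodic `N`-body Hamiltonian: the Beurling–Deny lattice

Topic `Literature/MathematicalPhysics/QuantumManyBody`, sequel of `PeriodicMaxFormBound.lean` and
`PeriodicFormSpectrum.lean`; first support file of the proof of the named fact
`Literature.MathematicalPhysics.QuantumManyBody.PeriodicGroundStateNondegenerateIntegrable`
(Reed–Simon IV, Thm XIII.48(a) = Faris–Simon 1975, on the torus: for an INTEGRABLE pair potential the
bosonic ground state of `-Δ + W` is simple).

For `L > 0`, a measurable profile `v` with `∫_{[0,L)^{3N}} W < ∞`, `W = ∑_{i<j} v^per(xᵢ - xⱼ)`, we work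
on `H = L²((ℝ/ℤ)^{3N})` (Haar probability measure, the convention of `PeriodicFormDomain.lean`) with
the MAXIMAL FORM (B. Simon, *J. Operator Theory* 1 (1979) 37–47; the tree's `PeriodicMaxFormBound.lean`,
where it is written inline)

  `maxForm v L η = maxFormKin L η + maxFormPot v L η`,
  `maxFormKin L η = ∑ₙ (∑ₚ (2πnₚ/L)²) |⟪eₙ, η⟫|²`,  `maxFormPot v L η = ∫ (W ∘ fromUnitTorusN L) |η|²`,

the closed subspace `boseSymmetric N` of classes that are Bose-symmetric in momentum space
(`⟪e_{n∘(σ×id)}, η⟫ = ⟪eₙ, η⟫`), and the **ground-state class**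

  `maxFormGroundStates v N L = {η ∈ boseSymmetric N | maxForm v L η ≤ E₀ ‖η‖²}`,
  `E₀ = periodicGroundStateEnergy v N L`,

i.e. the minimisers of the Rayleigh quotient of the maximal form in the Bose sector together with `0`
(by the maximal-form bound `periodicGroundStateEnergy_mul_le_maxForm` of the tree, `E₀‖η‖² ≤ maxForm η` on
the whole Bose sector, so the inequality is an equality).

**Main results** (all proved; the definitions above and the lattice maps `absLp`, `conjLp`, `reLp`,
`imLp`, `posPartLp`, `negPartLp` on `L²`).
* `maxFormGroundStates` is a `ℂ`-subspace (`add_mem_maxFormGroundStates`, `smul_mem_maxFormGroundStates`;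
  parallelogram law of the maximal form) that is closed under complex conjugation and under
  `η ↦ |η|` (`conjLp_mem_maxFormGroundStates`, `absLp_mem_maxFormGroundStates`): **the Beurling–Deny /
  Reed–Simon step "`|ψ|` is again a ground state"** [ReedSimonIV1978, Thm XIII.43, proof of (c) ⇒ (a),
  and Thm XIII.50 (b)] at the level of the form, where it is the contraction of the spectral kinetic
  energy under `1`-Lipschitz maps of the tree (`Torus.tsum_weight_mul_enorm_mFourierCoeff_comp_le`,
  Gilbarg–Trudinger Lemma 7.6) — hence also under real/imaginary/positive/negative parts of REAL
  ground states.
* `formEmbed_mem_maxFormGroundStates_of_gramOp_eq` — **bridge to the closed form of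
  `PeriodicFormDomain.lean`**: if `u ∈ Q` is an eigenvector of the Gram operator `ι†ι` for its top
  eigenvalue `κ₁` (a variational ground state, `periodicGroundStateEnergy = κ₁⁻¹ - 1`,
  `PeriodicFormSpectrum.lean`), then its `L²` class `ι u` lies in `maxFormGroundStates` (lower
  semicontinuity of the maximal form along the core approximants of `u`, `maxForm_le_of_tendsto`).

The strict positivity of non-negative ground states (Faris–Simon) and the conclusion (simplicity) are in
the sequel files `PeriodicMaxFormPositivity.lean` and `PeriodicGroundStateNondegenerateProofs.lean`.

## References

* M. Reed, B. Simon, *Methods of Modern Mathematical Physics IV* (1978), §XIII.12, Thms XIII.43–XIII.44,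
  XIII.48, Appendix 1 (Beurling–Deny criteria, Thm XIII.50). [ReedSimonIV1978]
* W. Faris, B. Simon, *Degenerate and non-degenerate ground states for Schrödinger operators*, Duke
  Math. J. 42 (1975) 559–567. [FarisSimon1975]
* B. Simon, *Maximal and minimal Schrödinger forms*, J. Operator Theory 1 (1979) 37–47. [Simon1979Forms]
* D. Gilbarg, N. S. Trudinger, *Elliptic PDE of Second Order*, Lemma 7.6.
-/

noncomputable section

open MeasureTheory Filter Set Complex UnitAddTorus
open scoped ENNReal NNReal Topology InnerProductSpace ComplexConjugate
open Literature.Analysis.FunctionSpaces Literature.Analysis.OperatorTheory Literature.Analysis.InnerProduct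

namespace Literature.MathematicalPhysics.QuantumManyBody.BoseGas

-- The measure on `ℝ/ℤ` is the Haar PROBABILITY measure, as in `PeriodicFormDomain.lean`.
attribute [local instance] formDomain_measureSpace formDomain_isProbabilityMeasure formDomain_isProbabilityMeasure_pi

variable {N : ℕ} {L : ℝ} {v : ℝ → ℝ≥0∞}

/-- Local notation for the Hilbert space `L²((ℝ/ℤ)^{3N})`, as in `PeriodicFormDomain.lean`. -/
local notation "L2T " N':max => Lp ℂ 2 (volume : Measure (UnitAddTorus (Fin N' × Fin 3)))

/-- The periodic interaction of a measurable profile is measurable (copy of the lemma of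
`DiluteBoseGasUpperBoundLocalization.lean`, kept private to avoid that import). [folklore] -/
private theorem measurable_periodicInteraction_gs (hv : Measurable v) (L : ℝ) :
    Measurable (periodicInteraction (N := N) v L) := by
  unfold periodicInteraction periodizedPotential
  refine Finset.measurable_sum _ fun i _ => Finset.measurable_sum _ fun j _ => ?_
  exact (Measurable.tsum fun n => hv.comp (measurable_id.sub_const _).norm).comp
    ((measurable_config_apply i).sub (measurable_config_apply j))

/-! ### The maximal form -/

/-- **The kinetic part of the maximal form** (spectral kinetic energy on the torus of side `L`):
`maxFormKin L η = ∑ₙ (∑ₚ (2πnₚ/L)²) |⟪eₙ, η⟫|²` for `η ∈ L²((ℝ/ℤ)^{3N})`. [cite: Simon1979Forms, Thm. 2.1] -/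
def maxFormKin (L : ℝ) (η : L2T N) : ℝ≥0∞ :=
  ∑' n : Fin N × Fin 3 → ℤ, ENNReal.ofReal (∑ p, (2 * Real.pi * (n p : ℝ) / L) ^ 2) *
    ((‖⟪(mFourierLp 2 n : L2T N), η⟫_ℂ‖₊ : ℝ≥0∞)) ^ 2

/-- **The potential part of the maximal form**: `maxFormPot v L η = ∫ (W ∘ fromUnitTorusN L) |η|²`,
`W = ∑_{i<j} v^per(xᵢ - xⱼ)`. [cite: Simon1979Forms, Thm. 2.1] -/
def maxFormPot (v : ℝ → ℝ≥0∞) (L : ℝ) (η : L2T N) : ℝ≥0∞ :=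
  ∫⁻ t, periodicInteraction v L (fromUnitTorusN L t) *
    ((‖(η : UnitAddTorus (Fin N × Fin 3) → ℂ) t‖₊ : ℝ≥0∞)) ^ 2

/-- **The maximal form** `maxForm v L η = ∑ₙ (∑ₚ (2πnₚ/L)²) |⟪eₙ, η⟫|² + ∫ (W ∘ fromUnitTorusN L) |η|² ∈ [0, ∞]`
of the periodic `N`-body Hamiltonian `-∑ⱼΔⱼ + W` on `L²((ℝ/ℤ)^{3N})` (finite exactly on
`H¹ ∩ {∫ W|η|² < ∞}`). [cite: Simon1979Forms, Thm. 2.1] -/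
def maxForm (v : ℝ → ℝ≥0∞) (L : ℝ) (η : L2T N) : ℝ≥0∞ :=
  maxFormKin L η + maxFormPot v L η

/-- Unfolding `maxForm`. [folklore] -/
theorem maxForm_def (v : ℝ → ℝ≥0∞) (L : ℝ) (η : L2T N) :
    maxForm v L η = maxFormKin L η + maxFormPot v L η := rfl

/-- **The Bose sector in momentum space**: the classes `η ∈ L²((ℝ/ℤ)^{3N})` whose Fourier coefficients are
invariant under the particle permutations, `⟪e_{n∘(σ×id)}, η⟫ = ⟪eₙ, η⟫` (equivalently `η(t∘(σ×id)) = η(t)`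
a.e., `ae_eq_comp_perm_of_inner_symm`); a `ℂ`-subspace. [folklore] -/
def boseSymmetric (N : ℕ) : Submodule ℂ (L2T N) where
  carrier := {η | ∀ (σ : Equiv.Perm (Fin N)) (n : Fin N × Fin 3 → ℤ),
    ⟪(mFourierLp 2 (fun p : Fin N × Fin 3 => n (σ p.1, p.2)) : L2T N), η⟫_ℂ = ⟪(mFourierLp 2 n : L2T N), η⟫_ℂ}
  zero_mem' := fun σ n => by simp only [inner_zero_right]
  add_mem' := fun ha hb σ n => by rw [inner_add_right, inner_add_right, ha σ n, hb σ n]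
  smul_mem' := fun c x hx σ n => by
    show ⟪_, c • x⟫_ℂ = ⟪_, c • x⟫_ℂ
    rw [inner_smul_right, inner_smul_right, hx σ n]

/-- Membership in the Bose sector. [folklore] -/
theorem mem_boseSymmetric {η : L2T N} :
    η ∈ boseSymmetric N ↔ ∀ (σ : Equiv.Perm (Fin N)) (n : Fin N × Fin 3 → ℤ),
      ⟪(mFourierLp 2 (fun p : Fin N × Fin 3 => n (σ p.1, p.2)) : L2T N), η⟫_ℂ = ⟪(mFourierLp 2 n : L2T N), η⟫_ℂ :=
  Iff.rfl

/-- **The Bose sector is closed** in `L²`. [folklore] -/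
theorem isClosed_boseSymmetric : IsClosed (boseSymmetric N : Set (L2T N)) := by
  have h : (boseSymmetric N : Set (L2T N)) = ⋂ σ : Equiv.Perm (Fin N), ⋂ n : Fin N × Fin 3 → ℤ,
      {η : L2T N | ⟪(mFourierLp 2 (fun p : Fin N × Fin 3 => n (σ p.1, p.2)) : L2T N), η⟫_ℂ =
        ⟪(mFourierLp 2 n : L2T N), η⟫_ℂ} := by
    ext η
    simp only [SetLike.mem_coe, mem_boseSymmetric, mem_iInter, mem_setOf_eq]
  rw [h]
  exact isClosed_iInter fun σ => isClosed_iInter fun n =>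
    isClosed_eq (continuous_const.inner continuous_id) (continuous_const.inner continuous_id)

/-- **The ground-state class of the maximal form in the Bose sector**: the Bose-symmetric classes with
`maxForm v L η ≤ E₀ ‖η‖²`, `E₀ = periodicGroundStateEnergy v N L` — by the maximal-form bound these are the
minimisers of the Rayleigh quotient of the maximal form (together with `0`), i.e. the (variational)
ground states of `-∑ⱼΔⱼ + W` on the symmetric subspace. [cite: ReedSimonIV1978, §XIII.12] -/
def maxFormGroundStates (v : ℝ → ℝ≥0∞) (N : ℕ) (L : ℝ) : Set (L2T N) :=
  {η | η ∈ boseSymmetric N ∧ maxForm v L η ≤ periodicGroundStateEnergy v N L * ENNReal.ofReal (‖η‖ ^ 2)}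

/-- Membership in the ground-state class. [folklore] -/
theorem mem_maxFormGroundStates {η : L2T N} :
    η ∈ maxFormGroundStates v N L ↔ η ∈ boseSymmetric N ∧
      maxForm v L η ≤ periodicGroundStateEnergy v N L * ENNReal.ofReal (‖η‖ ^ 2) :=
  Iff.rfl

/-! ### Scaling, zero, and the maximal-form bound -/

/-- `maxFormKin (c • η) = |c|² maxFormKin η`. [folklore] -/
theorem maxFormKin_smul (L : ℝ) (c : ℂ) (η : L2T N) :
    maxFormKin L (c • η) = ENNReal.ofReal (‖c‖ ^ 2) * maxFormKin L η :=
  tsum_weight_inner_smul _ c η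

/-- `maxFormPot (c • η) = |c|² maxFormPot η`. [folklore] -/
theorem maxFormPot_smul (v : ℝ → ℝ≥0∞) (L : ℝ) (c : ℂ) (η : L2T N) :
    maxFormPot v L (c • η) = ENNReal.ofReal (‖c‖ ^ 2) * maxFormPot v L η :=
  lintegral_weight_smul_sq _ c η

/-- `maxForm (c • η) = |c|² maxForm η`. [folklore] -/
theorem maxForm_smul (v : ℝ → ℝ≥0∞) (L : ℝ) (c : ℂ) (η : L2T N) :
    maxForm v L (c • η) = ENNReal.ofReal (‖c‖ ^ 2) * maxForm v L η := by
  rw [maxForm, maxForm, maxFormKin_smul, maxFormPot_smul, mul_add]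

/-- `maxForm 0 = 0`. [folklore] -/
theorem maxForm_zero (v : ℝ → ℝ≥0∞) (L : ℝ) : maxForm v L (0 : L2T N) = 0 := by
  have h := maxForm_smul v L 0 (0 : L2T N)
  rwa [zero_smul, norm_zero, zero_pow two_ne_zero, ENNReal.ofReal_zero, zero_mul] at h

/-- **The maximal-form bound** (tree, `periodicGroundStateEnergy_mul_le_maxForm`): on the Bose sector
`E₀ ‖η‖² ≤ maxForm v L η`. [cite: Simon1979Forms, Thm. 2.1] -/
theorem periodicGroundStateEnergy_mul_le_maxForm_of_mem (hL : 0 < L) (hv : Measurable v)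
    (hW : ∫⁻ X in cellN N L, periodicInteraction v L X ≠ ⊤) {η : L2T N} (hη : η ∈ boseSymmetric N) :
    periodicGroundStateEnergy v N L * ENNReal.ofReal (‖η‖ ^ 2) ≤ maxForm v L η :=
  periodicGroundStateEnergy_mul_le_maxForm hL hv hW η hη

/-- On the ground-state class the bound is an equality: `maxForm v L η = E₀ ‖η‖²`. [folklore] -/
theorem maxForm_eq_of_mem_maxFormGroundStates (hL : 0 < L) (hv : Measurable v)
    (hW : ∫⁻ X in cellN N L, periodicInteraction v L X ≠ ⊤) {η : L2T N} (hη : η ∈ maxFormGroundStates v N L) :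
    maxForm v L η = periodicGroundStateEnergy v N L * ENNReal.ofReal (‖η‖ ^ 2) :=
  le_antisymm hη.2 (periodicGroundStateEnergy_mul_le_maxForm_of_mem hL hv hW hη.1)

/-- Ground states have finite maximal form (when `E₀ < ∞`). [folklore] -/
theorem maxForm_ne_top_of_mem_maxFormGroundStates (hE : periodicGroundStateEnergy v N L ≠ ⊤) {η : L2T N}
    (hη : η ∈ maxFormGroundStates v N L) : maxForm v L η ≠ ⊤ :=
  ne_top_of_le_ne_top (ENNReal.mul_ne_top hE ENNReal.ofReal_ne_top) hη.2

/-- Ground states have finite kinetic energy. [folklore] -/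
theorem maxFormKin_ne_top_of_mem_maxFormGroundStates (hE : periodicGroundStateEnergy v N L ≠ ⊤) {η : L2T N}
    (hη : η ∈ maxFormGroundStates v N L) : maxFormKin L η ≠ ⊤ :=
  ne_top_of_le_ne_top (maxForm_ne_top_of_mem_maxFormGroundStates hE hη) (self_le_add_right _ _)

/-- Ground states have finite potential energy. [folklore] -/
theorem maxFormPot_ne_top_of_mem_maxFormGroundStates (hE : periodicGroundStateEnergy v N L ≠ ⊤) {η : L2T N}
    (hη : η ∈ maxFormGroundStates v N L) : maxFormPot v L η ≠ ⊤ :=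
  ne_top_of_le_ne_top (maxForm_ne_top_of_mem_maxFormGroundStates hE hη) (self_le_add_left _ _)

/-- `0` is in the ground-state class. [folklore] -/
theorem zero_mem_maxFormGroundStates (v : ℝ → ℝ≥0∞) (N : ℕ) (L : ℝ) : (0 : L2T N) ∈ maxFormGroundStates v N L :=
  ⟨(boseSymmetric N).zero_mem, by rw [maxForm_zero]; exact bot_le⟩

/-- The ground-state class is closed under scalars. [folklore] -/
theorem smul_mem_maxFormGroundStates (c : ℂ) {η : L2T N} (hη : η ∈ maxFormGroundStates v N L) :
    c • η ∈ maxFormGroundStates v N L := by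
  refine ⟨(boseSymmetric N).smul_mem c hη.1, ?_⟩
  rw [maxForm_smul, norm_smul, mul_pow, ENNReal.ofReal_mul (sq_nonneg _), mul_left_comm]
  exact mul_le_mul' le_rfl hη.2

/-- The ground-state class is closed under negation. [folklore] -/
theorem neg_mem_maxFormGroundStates {η : L2T N} (hη : η ∈ maxFormGroundStates v N L) :
    -η ∈ maxFormGroundStates v N L := by
  have h := smul_mem_maxFormGroundStates (-1 : ℂ) hη
  rwa [neg_one_smul] at h

/-! ### The parallelogram law of the maximal form: the ground-state class is a subspace -/

/-- The parallelogram law for squared norms in `[0, ∞]`. [folklore] -/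
theorem coe_nnnorm_sq_parallelogram (a b : ℂ) :
    ((‖a + b‖₊ : ℝ≥0∞)) ^ 2 + ((‖a - b‖₊ : ℝ≥0∞)) ^ 2 =
      2 * ((‖a‖₊ : ℝ≥0∞)) ^ 2 + 2 * ((‖b‖₊ : ℝ≥0∞)) ^ 2 := by
  simp only [coe_nnnorm_sq_eq_ofReal]
  have h2 : ∀ x : ℝ, 0 ≤ x → (2 : ℝ≥0∞) * ENNReal.ofReal x = ENNReal.ofReal (2 * x) := fun x _ => by
    rw [ENNReal.ofReal_mul zero_le_two, ENNReal.ofReal_ofNat]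
  rw [h2 _ (sq_nonneg _), h2 _ (sq_nonneg _), ← ENNReal.ofReal_add (sq_nonneg _) (sq_nonneg _),
    ← ENNReal.ofReal_add (by positivity) (by positivity)]
  congr 1
  have h := parallelogram_law_with_norm ℂ a b
  simp only [sq]
  linarith [h]

/-- **Parallelogram law of the kinetic part.** [folklore] -/
theorem maxFormKin_parallelogram (L : ℝ) (η ξ : L2T N) :
    maxFormKin L (η + ξ) + maxFormKin L (η - ξ) = 2 * maxFormKin L η + 2 * maxFormKin L ξ := by
  unfold maxFormKin
  rw [← ENNReal.tsum_add, ← ENNReal.tsum_mul_left, ← ENNReal.tsum_mul_left, ← ENNReal.tsum_add]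
  refine tsum_congr fun n => ?_
  rw [inner_add_right, inner_sub_right, ← mul_add, coe_nnnorm_sq_parallelogram]
  ring

/-- The weight `W ∘ fromUnitTorusN L` is measurable. [folklore] -/
theorem measurable_periodicInteraction_fromUnitTorusN (hv : Measurable v) (L : ℝ) :
    Measurable fun t : UnitAddTorus (Fin N × Fin 3) => periodicInteraction v L (fromUnitTorusN L t) :=
  (measurable_periodicInteraction_gs hv L).comp (measurable_fromUnitTorusN L)

/-- The integrand of the potential part is a.e.-measurable. [folklore] -/
theorem aemeasurable_pot_integrand (hv : Measurable v) (L : ℝ) (η : L2T N) :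
    AEMeasurable (fun t : UnitAddTorus (Fin N × Fin 3) => periodicInteraction v L (fromUnitTorusN L t) *
      ((‖(η : UnitAddTorus (Fin N × Fin 3) → ℂ) t‖₊ : ℝ≥0∞)) ^ 2) volume :=
  (measurable_periodicInteraction_fromUnitTorusN hv L).aemeasurable.mul
    ((Lp.aestronglyMeasurable η).aemeasurable.nnnorm.coe_nnreal_ennreal.pow_const 2)

/-- **Parallelogram law of the potential part.** [folklore] -/
theorem maxFormPot_parallelogram (hv : Measurable v) (L : ℝ) (η ξ : L2T N) :
    maxFormPot v L (η + ξ) + maxFormPot v L (η - ξ) = 2 * maxFormPot v L η + 2 * maxFormPot v L ξ := by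
  unfold maxFormPot
  rw [← lintegral_add_left' (aemeasurable_pot_integrand hv L _),
    ← lintegral_const_mul' _ _ ENNReal.ofNat_ne_top, ← lintegral_const_mul' _ _ ENNReal.ofNat_ne_top,
    ← lintegral_add_left' ((aemeasurable_pot_integrand hv L _).const_mul _)]
  refine lintegral_congr_ae ?_
  filter_upwards [Lp.coeFn_add η ξ, Lp.coeFn_sub η ξ] with t hadd hsub
  rw [hadd, hsub, Pi.add_apply, Pi.sub_apply, ← mul_add, coe_nnnorm_sq_parallelogram]
  ring

/-- **Parallelogram law of the maximal form.** [folklore] -/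
theorem maxForm_parallelogram (hv : Measurable v) (L : ℝ) (η ξ : L2T N) :
    maxForm v L (η + ξ) + maxForm v L (η - ξ) = 2 * maxForm v L η + 2 * maxForm v L ξ := by
  simp only [maxForm]
  calc maxFormKin L (η + ξ) + maxFormPot v L (η + ξ) + (maxFormKin L (η - ξ) + maxFormPot v L (η - ξ))
      = (maxFormKin L (η + ξ) + maxFormKin L (η - ξ)) + (maxFormPot v L (η + ξ) + maxFormPot v L (η - ξ)) := by
        ring
    _ = _ := by rw [maxFormKin_parallelogram, maxFormPot_parallelogram hv]; ring

/-- **The ground-state class is closed under addition** (`E₀ < ∞`): by the parallelogram law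
`maxForm(η+ξ) + maxForm(η-ξ) = 2E₀‖η‖² + 2E₀‖ξ‖² = E₀‖η+ξ‖² + E₀‖η-ξ‖²`, and `maxForm(η-ξ) ≥ E₀‖η-ξ‖²`.
[folklore] -/
theorem add_mem_maxFormGroundStates (hL : 0 < L) (hv : Measurable v)
    (hW : ∫⁻ X in cellN N L, periodicInteraction v L X ≠ ⊤) (hE : periodicGroundStateEnergy v N L ≠ ⊤)
    {η ξ : L2T N} (hη : η ∈ maxFormGroundStates v N L) (hξ : ξ ∈ maxFormGroundStates v N L) :
    η + ξ ∈ maxFormGroundStates v N L := by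
  set E := periodicGroundStateEnergy v N L with hEdef
  refine ⟨(boseSymmetric N).add_mem hη.1 hξ.1, ?_⟩
  have hlow : E * ENNReal.ofReal (‖η - ξ‖ ^ 2) ≤ maxForm v L (η - ξ) :=
    periodicGroundStateEnergy_mul_le_maxForm_of_mem hL hv hW ((boseSymmetric N).sub_mem hη.1 hξ.1)
  have hsum : maxForm v L (η + ξ) + maxForm v L (η - ξ) ≤
      E * ENNReal.ofReal (‖η + ξ‖ ^ 2) + E * ENNReal.ofReal (‖η - ξ‖ ^ 2) := by
    rw [maxForm_parallelogram hv]
    calc 2 * maxForm v L η + 2 * maxForm v L ξ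
        ≤ 2 * (E * ENNReal.ofReal (‖η‖ ^ 2)) + 2 * (E * ENNReal.ofReal (‖ξ‖ ^ 2)) := by
          gcongr
          · exact hη.2
          · exact hξ.2
      _ = E * ENNReal.ofReal (2 * ‖η‖ ^ 2 + 2 * ‖ξ‖ ^ 2) := by
          rw [ENNReal.ofReal_add (by positivity) (by positivity), ENNReal.ofReal_mul zero_le_two,
            ENNReal.ofReal_mul zero_le_two, ENNReal.ofReal_ofNat]
          ring
      _ = E * ENNReal.ofReal (‖η + ξ‖ ^ 2 + ‖η - ξ‖ ^ 2) := by
          congr 1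
          congr 1
          have h := parallelogram_law_with_norm ℂ η ξ
          simp only [sq]
          linarith [h]
      _ = E * ENNReal.ofReal (‖η + ξ‖ ^ 2) + E * ENNReal.ofReal (‖η - ξ‖ ^ 2) := by
          rw [ENNReal.ofReal_add (sq_nonneg _) (sq_nonneg _), mul_add]
  have hfin : E * ENNReal.ofReal (‖η - ξ‖ ^ 2) ≠ ⊤ := ENNReal.mul_ne_top hE ENNReal.ofReal_ne_top
  calc maxForm v L (η + ξ)
      = maxForm v L (η + ξ) + E * ENNReal.ofReal (‖η - ξ‖ ^ 2) - E * ENNReal.ofReal (‖η - ξ‖ ^ 2) :=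
        (ENNReal.add_sub_cancel_right hfin).symm
    _ ≤ maxForm v L (η + ξ) + maxForm v L (η - ξ) - E * ENNReal.ofReal (‖η - ξ‖ ^ 2) :=
        tsub_le_tsub_right (add_le_add le_rfl hlow) _
    _ ≤ E * ENNReal.ofReal (‖η + ξ‖ ^ 2) + E * ENNReal.ofReal (‖η - ξ‖ ^ 2) - E * ENNReal.ofReal (‖η - ξ‖ ^ 2) :=
        tsub_le_tsub_right hsum _
    _ = E * ENNReal.ofReal (‖η + ξ‖ ^ 2) := ENNReal.add_sub_cancel_right hfin

/-- The ground-state class is closed under subtraction. [folklore] -/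
theorem sub_mem_maxFormGroundStates (hL : 0 < L) (hv : Measurable v)
    (hW : ∫⁻ X in cellN N L, periodicInteraction v L X ≠ ⊤) (hE : periodicGroundStateEnergy v N L ≠ ⊤)
    {η ξ : L2T N} (hη : η ∈ maxFormGroundStates v N L) (hξ : ξ ∈ maxFormGroundStates v N L) :
    η - ξ ∈ maxFormGroundStates v N L := by
  rw [sub_eq_add_neg]
  exact add_mem_maxFormGroundStates hL hv hW hE hη (neg_mem_maxFormGroundStates hξ)

/-! ### Lipschitz maps of the values: the Beurling–Deny lattice operations -/

section Lipschitz

variable {Φ : ℂ → ℂ} {K : ℝ≥0}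

/-- The Fourier coefficients of `Φ ∘ η` (as a class) are those of the composed representative. [folklore] -/
theorem mFourierCoeff_compLp (hΦ : LipschitzWith K Φ) (h0 : Φ 0 = 0) (η : L2T N) (n : Fin N × Fin 3 → ℤ) :
    mFourierCoeff ((hΦ.compLp h0 η : L2T N) : UnitAddTorus (Fin N × Fin 3) → ℂ) n =
      mFourierCoeff (Φ ∘ (η : UnitAddTorus (Fin N × Fin 3) → ℂ)) n :=
  integral_congr_ae ((hΦ.coeFn_compLp h0 η).mono fun t ht => by simp only [ht])

/-- **Lipschitz maps of the values contract the kinetic part**: `maxFormKin (Φ ∘ η) ≤ K² maxFormKin η` for a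
`K`-Lipschitz `Φ : ℂ → ℂ` with `Φ 0 = 0` (the tree's `Torus.tsum_weight_mul_enorm_mFourierCoeff_comp_le`,
Gilbarg–Trudinger Lemma 7.6 in Fourier dress). [cite: ReedSimonIV1978, Thm XIII.50 (b) and Thm XIII.51 (d)] -/
theorem maxFormKin_compLp_le (hΦ : LipschitzWith K Φ) (h0 : Φ 0 = 0) (η : L2T N) :
    maxFormKin L (hΦ.compLp h0 η) ≤ (K : ℝ≥0∞) ^ 2 * maxFormKin L η := by
  classical
  have hηmem : MemLp (η : UnitAddTorus (Fin N × Fin 3) → ℂ) 2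
      (Measure.pi fun _ : Fin N × Fin 3 => (AddCircle.haarAddCircle : Measure UnitAddCircle)) := Lp.memLp η
  have h := Torus.tsum_weight_mul_enorm_mFourierCoeff_comp_le (d := Fin N × Fin 3) hΦ h0
    (memLp_piHaar_iff.1 hηmem) (c := fun _ => (2 * Real.pi / L) ^ 2) (fun _ => sq_nonneg _)
  have hw : ∀ n : Fin N × Fin 3 → ℤ, ENNReal.ofReal (∑ p, (2 * Real.pi * (n p : ℝ) / L) ^ 2) =
      ENNReal.ofReal (∑ p, (2 * Real.pi / L) ^ 2 * (n p : ℝ) ^ 2) := fun n => by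
    congr 1
    refine Finset.sum_congr rfl fun p _ => ?_
    ring
  have hcoef : ∀ (x : L2T N) (n : Fin N × Fin 3 → ℤ), ((‖⟪(mFourierLp 2 n : L2T N), x⟫_ℂ‖₊ : ℝ≥0∞)) ^ 2 =
      ‖mFourierCoeff (x : UnitAddTorus (Fin N × Fin 3) → ℂ) n‖ₑ ^ 2 := fun x n => by
    rw [HaarTorus.inner_mFourierLp_eq_mFourierCoeff, enorm_eq_nnnorm]
  unfold maxFormKin
  simp only [hw, hcoef, mFourierCoeff_compLp hΦ h0]
  exact h

/-- **`1`-Lipschitz maps of the values do not increase the kinetic part.** [cite: ReedSimonIV1978, Thm XIII.51 (d)] -/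
theorem maxFormKin_compLp_le_of_one (hΦ : LipschitzWith 1 Φ) (h0 : Φ 0 = 0) (η : L2T N) :
    maxFormKin L (hΦ.compLp h0 η) ≤ maxFormKin L η := by
  simpa only [ENNReal.coe_one, one_pow, one_mul] using maxFormKin_compLp_le (L := L) hΦ h0 η

/-- Maps of the values that do not increase moduli do not increase the potential part. [folklore] -/
theorem maxFormPot_compLp_le (hΦ : LipschitzWith K Φ) (h0 : Φ 0 = 0) (hle : ∀ z, ‖Φ z‖ ≤ ‖z‖) (η : L2T N) :
    maxFormPot v L (hΦ.compLp h0 η) ≤ maxFormPot v L η := by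
  refine lintegral_mono_ae ((hΦ.coeFn_compLp h0 η).mono fun t ht => ?_)
  rw [ht, Function.comp_apply]
  gcongr
  exact hle _

/-- Maps of the values that preserve moduli preserve the potential part. [folklore] -/
theorem maxFormPot_compLp_eq (hΦ : LipschitzWith K Φ) (h0 : Φ 0 = 0) (heq : ∀ z, ‖Φ z‖ = ‖z‖) (η : L2T N) :
    maxFormPot v L (hΦ.compLp h0 η) = maxFormPot v L η := by
  refine lintegral_congr_ae ((hΦ.coeFn_compLp h0 η).mono fun t ht => ?_)
  dsimp only
  rw [ht, Function.comp_apply, ← enorm_eq_nnnorm, ← enorm_eq_nnnorm, ← ofReal_norm, ← ofReal_norm, heq]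

/-- Maps of the values that preserve moduli preserve the `L²` norm. [folklore] -/
theorem norm_compLp_eq (hΦ : LipschitzWith K Φ) (h0 : Φ 0 = 0) (heq : ∀ z, ‖Φ z‖ = ‖z‖) (η : L2T N) :
    ‖(hΦ.compLp h0 η : L2T N)‖ = ‖η‖ := by
  rw [Lp.norm_def, Lp.norm_def]
  congr 1
  exact eLpNorm_congr_norm_ae ((hΦ.coeFn_compLp h0 η).mono fun t ht => by rw [ht, Function.comp_apply, heq])

/-- Maps of the values that do not increase moduli do not increase the `L²` norm. [folklore] -/
theorem norm_compLp_le (hΦ : LipschitzWith K Φ) (h0 : Φ 0 = 0) (hle : ∀ z, ‖Φ z‖ ≤ ‖z‖) (η : L2T N) :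
    ‖(hΦ.compLp h0 η : L2T N)‖ ≤ ‖η‖ := by
  rw [Lp.norm_def, Lp.norm_def]
  refine ENNReal.toReal_mono (Lp.eLpNorm_ne_top η) ?_
  exact eLpNorm_mono_ae ((hΦ.coeFn_compLp h0 η).mono fun t ht => by rw [ht, Function.comp_apply]; exact hle _)

/-- **Maps of the values preserve the Bose sector**: Bose symmetry is a.e. invariance under the particle
permutations of the torus coordinates, which composition with `Φ` preserves. [folklore] -/
theorem compLp_mem_boseSymmetric (hΦ : LipschitzWith K Φ) (h0 : Φ 0 = 0) {η : L2T N} (hη : η ∈ boseSymmetric N) :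
    (hΦ.compLp h0 η : L2T N) ∈ boseSymmetric N := by
  intro σ n
  set τ : Equiv.Perm (Fin N × Fin 3) := Equiv.prodCongr σ (Equiv.refl (Fin 3)) with hτ
  have hτn : ∀ m : Fin N × Fin 3 → ℤ, (fun i => m (τ i)) = fun p : Fin N × Fin 3 => m (σ p.1, p.2) :=
    fun m => comp_prodCongr_eq σ m
  have hηae : ∀ᵐ t ∂(volume : Measure (UnitAddTorus (Fin N × Fin 3))),
      (η : UnitAddTorus (Fin N × Fin 3) → ℂ) (fun i => t (τ i)) = (η : UnitAddTorus (Fin N × Fin 3) → ℂ) t :=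
    ae_eq_comp_perm_of_inner_symm η τ fun m => by rw [hτn]; exact hη σ m
  set f : L2T N := hΦ.compLp h0 η with hf
  have hfc := hΦ.coeFn_compLp h0 η
  have hfcT : ∀ᵐ t ∂(volume : Measure (UnitAddTorus (Fin N × Fin 3))),
      (f : UnitAddTorus (Fin N × Fin 3) → ℂ) (fun i => t (τ i)) =
        Φ ((η : UnitAddTorus (Fin N × Fin 3) → ℂ) (fun i => t (τ i))) := by
    have h := (measurePreserving_compPerm (D := Fin N × Fin 3) τ).quasiMeasurePreserving.ae_eq_comp hfc
    filter_upwards [h] with t ht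
    simpa only [Function.comp_apply, compPerm_apply] using ht
  have hfae : ∀ᵐ t ∂(volume : Measure (UnitAddTorus (Fin N × Fin 3))),
      (f : UnitAddTorus (Fin N × Fin 3) → ℂ) (fun i => t (τ i)) = (f : UnitAddTorus (Fin N × Fin 3) → ℂ) t := by
    filter_upwards [hηae, hfc, hfcT] with t h1 h2 h3
    rw [h3, h1, h2, Function.comp_apply]
  rw [← hτn]
  exact inner_symm_of_ae_eq_comp_perm f τ hfae n

/-- **Beurling–Deny at the level of the maximal form**: a `1`-Lipschitz map of the values fixing `0` and
preserving moduli (`|·|`, complex conjugation) maps ground states to ground states. [cite: ReedSimonIV1978, Thm XIII.43 (c)⇒(a) and Thm XIII.50 (b)] -/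
theorem compLp_mem_maxFormGroundStates (hΦ : LipschitzWith 1 Φ) (h0 : Φ 0 = 0) (heq : ∀ z, ‖Φ z‖ = ‖z‖)
    {η : L2T N} (hη : η ∈ maxFormGroundStates v N L) : (hΦ.compLp h0 η : L2T N) ∈ maxFormGroundStates v N L := by
  refine ⟨compLp_mem_boseSymmetric hΦ h0 hη.1, ?_⟩
  rw [norm_compLp_eq hΦ h0 heq, maxForm, maxFormPot_compLp_eq hΦ h0 heq]
  exact (add_le_add (maxFormKin_compLp_le_of_one hΦ h0 η) le_rfl).trans hη.2

end Lipschitz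

/-! ### The lattice maps `|η|`, `conj η`, `re η`, `im η`, `η⁺`, `η⁻` on `L²` -/

/-- `z ↦ |z|` (as a complex number) is `1`-Lipschitz. [folklore] -/
theorem lipschitzWith_absC : LipschitzWith 1 (fun z : ℂ => ((‖z‖ : ℝ) : ℂ)) :=
  LipschitzWith.of_dist_le_mul fun z w => by
    rw [NNReal.coe_one, one_mul, Complex.dist_eq, ← Complex.ofReal_sub, Complex.norm_real, Real.norm_eq_abs,
      Complex.dist_eq]
    exact abs_norm_sub_norm_le z w

/-- `z ↦ conj z` is `1`-Lipschitz. [folklore] -/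
theorem lipschitzWith_conjC : LipschitzWith 1 (fun z : ℂ => conj z) :=
  LipschitzWith.of_dist_le_mul fun z w => by
    rw [NNReal.coe_one, one_mul, Complex.dist_eq, Complex.dist_eq, ← map_sub, Complex.norm_conj]

/-- `z ↦ re z` (as a complex number) is `1`-Lipschitz. [folklore] -/
theorem lipschitzWith_reC : LipschitzWith 1 (fun z : ℂ => ((z.re : ℝ) : ℂ)) :=
  LipschitzWith.of_dist_le_mul fun z w => by
    rw [NNReal.coe_one, one_mul, Complex.dist_eq, ← Complex.ofReal_sub, Complex.norm_real, Real.norm_eq_abs,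
      ← Complex.sub_re, Complex.dist_eq]
    exact Complex.abs_re_le_norm _

/-- `z ↦ im z` (as a complex number) is `1`-Lipschitz. [folklore] -/
theorem lipschitzWith_imC : LipschitzWith 1 (fun z : ℂ => ((z.im : ℝ) : ℂ)) :=
  LipschitzWith.of_dist_le_mul fun z w => by
    rw [NNReal.coe_one, one_mul, Complex.dist_eq, ← Complex.ofReal_sub, Complex.norm_real, Real.norm_eq_abs,
      ← Complex.sub_im, Complex.dist_eq]
    exact Complex.abs_im_le_norm _

/-- `x ↦ max x 0` is `1`-Lipschitz on `ℝ`: `|x⁺ - y⁺| ≤ |x - y|`. [folklore] -/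
theorem abs_max_zero_sub_max_zero_le (x y : ℝ) : |max x 0 - max y 0| ≤ |x - y| := by
  rcases le_total 0 x with hx | hx <;> rcases le_total 0 y with hy | hy
  · rw [max_eq_left hx, max_eq_left hy]
  · rw [max_eq_left hx, max_eq_right hy, sub_zero, abs_of_nonneg hx]
    exact (by linarith : x ≤ x - y).trans (le_abs_self _)
  · rw [max_eq_right hx, max_eq_left hy, zero_sub, abs_neg, abs_of_nonneg hy]
    rw [abs_sub_comm]
    exact (by linarith : y ≤ y - x).trans (le_abs_self _)
  · rw [max_eq_right hx, max_eq_right hy, sub_zero, abs_zero]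
    exact abs_nonneg _

/-- `z ↦ (re z)⁺` (as a complex number) is `1`-Lipschitz. [folklore] -/
theorem lipschitzWith_posPartC : LipschitzWith 1 (fun z : ℂ => ((max z.re 0 : ℝ) : ℂ)) :=
  LipschitzWith.of_dist_le_mul fun z w => by
    rw [NNReal.coe_one, one_mul, Complex.dist_eq, ← Complex.ofReal_sub, Complex.norm_real, Real.norm_eq_abs,
      Complex.dist_eq]
    exact (abs_max_zero_sub_max_zero_le _ _).trans (by rw [← Complex.sub_re]; exact Complex.abs_re_le_norm _)

/-- `z ↦ (re z)⁻ = (-re z)⁺` (as a complex number) is `1`-Lipschitz. [folklore] -/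
theorem lipschitzWith_negPartC : LipschitzWith 1 (fun z : ℂ => ((max (-z.re) 0 : ℝ) : ℂ)) :=
  LipschitzWith.of_dist_le_mul fun z w => by
    rw [NNReal.coe_one, one_mul, Complex.dist_eq, ← Complex.ofReal_sub, Complex.norm_real, Real.norm_eq_abs,
      Complex.dist_eq]
    refine (abs_max_zero_sub_max_zero_le _ _).trans ?_
    rw [show -z.re - -w.re = -(z - w).re by rw [Complex.sub_re]; ring, abs_neg]
    exact Complex.abs_re_le_norm _

/-- **`|η|`**: the class of the modulus `t ↦ |η t|` (complex-valued). [folklore] -/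
def absLp (η : L2T N) : L2T N := lipschitzWith_absC.compLp (by simp) η

/-- **`conj η`**: the class of the complex conjugate. [folklore] -/
def conjLp (η : L2T N) : L2T N := lipschitzWith_conjC.compLp (by simp) η

/-- **`re η`**: the class of the real part (complex-valued). [folklore] -/
def reLp (η : L2T N) : L2T N := lipschitzWith_reC.compLp (by simp) η

/-- **`im η`**: the class of the imaginary part (complex-valued). [folklore] -/
def imLp (η : L2T N) : L2T N := lipschitzWith_imC.compLp (by simp) η

/-- **`η⁺`**: the class of the positive part of the real part (complex-valued). [folklore] -/
def posPartLp (η : L2T N) : L2T N := lipschitzWith_posPartC.compLp (by simp) η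

/-- **`η⁻`**: the class of the negative part of the real part (complex-valued). [folklore] -/
def negPartLp (η : L2T N) : L2T N := lipschitzWith_negPartC.compLp (by simp) η

/-- `|η| t = |η t|` a.e. [folklore] -/
theorem coeFn_absLp (η : L2T N) :
    ∀ᵐ t ∂(volume : Measure (UnitAddTorus (Fin N × Fin 3))),
      (absLp η : UnitAddTorus (Fin N × Fin 3) → ℂ) t = ((‖(η : UnitAddTorus (Fin N × Fin 3) → ℂ) t‖ : ℝ) : ℂ) :=
  (lipschitzWith_absC.coeFn_compLp _ η).mono fun t ht => by rw [absLp, ht, Function.comp_apply]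

/-- `(conj η) t = conj (η t)` a.e. [folklore] -/
theorem coeFn_conjLp (η : L2T N) :
    ∀ᵐ t ∂(volume : Measure (UnitAddTorus (Fin N × Fin 3))),
      (conjLp η : UnitAddTorus (Fin N × Fin 3) → ℂ) t = conj ((η : UnitAddTorus (Fin N × Fin 3) → ℂ) t) :=
  (lipschitzWith_conjC.coeFn_compLp _ η).mono fun t ht => by rw [conjLp, ht, Function.comp_apply]

/-- `(re η) t = re (η t)` a.e. [folklore] -/
theorem coeFn_reLp (η : L2T N) :
    ∀ᵐ t ∂(volume : Measure (UnitAddTorus (Fin N × Fin 3))),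
      (reLp η : UnitAddTorus (Fin N × Fin 3) → ℂ) t = ((((η : UnitAddTorus (Fin N × Fin 3) → ℂ) t).re : ℝ) : ℂ) :=
  (lipschitzWith_reC.coeFn_compLp _ η).mono fun t ht => by rw [reLp, ht, Function.comp_apply]

/-- `(im η) t = im (η t)` a.e. [folklore] -/
theorem coeFn_imLp (η : L2T N) :
    ∀ᵐ t ∂(volume : Measure (UnitAddTorus (Fin N × Fin 3))),
      (imLp η : UnitAddTorus (Fin N × Fin 3) → ℂ) t = ((((η : UnitAddTorus (Fin N × Fin 3) → ℂ) t).im : ℝ) : ℂ) :=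
  (lipschitzWith_imC.coeFn_compLp _ η).mono fun t ht => by rw [imLp, ht, Function.comp_apply]

/-- `η⁺ t = (re (η t))⁺` a.e. [folklore] -/
theorem coeFn_posPartLp (η : L2T N) :
    ∀ᵐ t ∂(volume : Measure (UnitAddTorus (Fin N × Fin 3))),
      (posPartLp η : UnitAddTorus (Fin N × Fin 3) → ℂ) t =
        ((max (((η : UnitAddTorus (Fin N × Fin 3) → ℂ) t).re) 0 : ℝ) : ℂ) :=
  (lipschitzWith_posPartC.coeFn_compLp _ η).mono fun t ht => by rw [posPartLp, ht, Function.comp_apply]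

/-- `η⁻ t = (-re (η t))⁺` a.e. [folklore] -/
theorem coeFn_negPartLp (η : L2T N) :
    ∀ᵐ t ∂(volume : Measure (UnitAddTorus (Fin N × Fin 3))),
      (negPartLp η : UnitAddTorus (Fin N × Fin 3) → ℂ) t =
        ((max (-((η : UnitAddTorus (Fin N × Fin 3) → ℂ) t).re) 0 : ℝ) : ℂ) :=
  (lipschitzWith_negPartC.coeFn_compLp _ η).mono fun t ht => by rw [negPartLp, ht, Function.comp_apply]

/-- **`|η|` is a ground state if `η` is.** [cite: ReedSimonIV1978, Thm XIII.43 (c)⇒(a)] -/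
theorem absLp_mem_maxFormGroundStates {η : L2T N} (hη : η ∈ maxFormGroundStates v N L) :
    absLp η ∈ maxFormGroundStates v N L :=
  compLp_mem_maxFormGroundStates _ _ (fun z => by simp) hη

/-- **`conj η` is a ground state if `η` is** (the form is real). [cite: ReedSimonIV1978, Thm XIII.43] -/
theorem conjLp_mem_maxFormGroundStates {η : L2T N} (hη : η ∈ maxFormGroundStates v N L) :
    conjLp η ∈ maxFormGroundStates v N L :=
  compLp_mem_maxFormGroundStates _ _ (fun z => by simp) hη

/-- `‖|η|‖ = ‖η‖`. [folklore] -/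
theorem norm_absLp (η : L2T N) : ‖absLp η‖ = ‖η‖ := norm_compLp_eq _ _ (fun z => by simp) η

/-- `re η = ½ (η + conj η)`. [folklore] -/
theorem reLp_eq (η : L2T N) : reLp η = (2⁻¹ : ℂ) • (η + conjLp η) := by
  refine Lp.ext ?_
  filter_upwards [coeFn_reLp η, Lp.coeFn_smul (2⁻¹ : ℂ) (η + conjLp η), Lp.coeFn_add η (conjLp η),
    coeFn_conjLp η] with t h1 h2 h3 h4
  rw [h1, h2, Pi.smul_apply, h3, Pi.add_apply, h4, smul_eq_mul, Complex.add_conj]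
  push_cast
  ring

/-- `im η = -(i/2) (η - conj η)`. [folklore] -/
theorem imLp_eq (η : L2T N) : imLp η = (-(Complex.I / 2) : ℂ) • (η - conjLp η) := by
  refine Lp.ext ?_
  filter_upwards [coeFn_imLp η, Lp.coeFn_smul (-(Complex.I / 2) : ℂ) (η - conjLp η), Lp.coeFn_sub η (conjLp η),
    coeFn_conjLp η] with t h1 h2 h3 h4
  rw [h1, h2, Pi.smul_apply, h3, Pi.sub_apply, h4, smul_eq_mul, Complex.sub_conj]
  push_cast
  linear_combination ((((η : UnitAddTorus (Fin N × Fin 3) → ℂ) t).im : ℝ) : ℂ) * Complex.I_mul_I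

/-- `η = re η + i · im η`. [folklore] -/
theorem reLp_add_I_smul_imLp (η : L2T N) : reLp η + Complex.I • imLp η = η := by
  refine Lp.ext ?_
  filter_upwards [Lp.coeFn_add (reLp η) (Complex.I • imLp η), coeFn_reLp η, Lp.coeFn_smul Complex.I (imLp η),
    coeFn_imLp η] with t h1 h2 h3 h4
  rw [h1, Pi.add_apply, h2, h3, Pi.smul_apply, h4, smul_eq_mul, mul_comm]
  exact Complex.re_add_im _

/-- A class is REAL when it equals its conjugate; then `re η = η`. [folklore] -/
theorem reLp_eq_self_of_conjLp_eq {η : L2T N} (h : conjLp η = η) : reLp η = η := by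
  rw [reLp_eq, h]
  module

/-- For a real class, `η⁺ = ½ (|η| + η)`. [folklore] -/
theorem posPartLp_eq_of_conjLp_eq {η : L2T N} (h : conjLp η = η) : posPartLp η = (2⁻¹ : ℂ) • (absLp η + η) := by
  refine Lp.ext ?_
  have hre : ∀ᵐ t ∂(volume : Measure (UnitAddTorus (Fin N × Fin 3))),
      conj ((η : UnitAddTorus (Fin N × Fin 3) → ℂ) t) = (η : UnitAddTorus (Fin N × Fin 3) → ℂ) t := by
    filter_upwards [coeFn_conjLp η] with t ht
    rw [← ht, h]
  filter_upwards [coeFn_posPartLp η, Lp.coeFn_smul (2⁻¹ : ℂ) (absLp η + η), Lp.coeFn_add (absLp η) η,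
    coeFn_absLp η, hre] with t h1 h2 h3 h4 h5
  rw [h1, h2, Pi.smul_apply, h3, Pi.add_apply, h4, smul_eq_mul]
  have him : ((η : UnitAddTorus (Fin N × Fin 3) → ℂ) t).im = 0 := Complex.conj_eq_iff_im.1 h5
  have hzre : (η : UnitAddTorus (Fin N × Fin 3) → ℂ) t =
      ((((η : UnitAddTorus (Fin N × Fin 3) → ℂ) t).re : ℝ) : ℂ) := by
    apply Complex.ext <;> simp [him]
  generalize hr : ((η : UnitAddTorus (Fin N × Fin 3) → ℂ) t).re = r at hzre ⊢
  rw [hzre, Complex.norm_real, Real.norm_eq_abs]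
  rcases le_total 0 r with h0 | h0
  · rw [max_eq_left h0, abs_of_nonneg h0]
    ring
  · rw [max_eq_right h0, abs_of_nonpos h0]
    push_cast
    ring

/-- For a real class, `η⁻ = ½ (|η| - η)`. [folklore] -/
theorem negPartLp_eq_of_conjLp_eq {η : L2T N} (h : conjLp η = η) : negPartLp η = (2⁻¹ : ℂ) • (absLp η - η) := by
  refine Lp.ext ?_
  have hre : ∀ᵐ t ∂(volume : Measure (UnitAddTorus (Fin N × Fin 3))),
      conj ((η : UnitAddTorus (Fin N × Fin 3) → ℂ) t) = (η : UnitAddTorus (Fin N × Fin 3) → ℂ) t := by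
    filter_upwards [coeFn_conjLp η] with t ht
    rw [← ht, h]
  filter_upwards [coeFn_negPartLp η, Lp.coeFn_smul (2⁻¹ : ℂ) (absLp η - η), Lp.coeFn_sub (absLp η) η,
    coeFn_absLp η, hre] with t h1 h2 h3 h4 h5
  rw [h1, h2, Pi.smul_apply, h3, Pi.sub_apply, h4, smul_eq_mul]
  have him : ((η : UnitAddTorus (Fin N × Fin 3) → ℂ) t).im = 0 := Complex.conj_eq_iff_im.1 h5
  have hzre : (η : UnitAddTorus (Fin N × Fin 3) → ℂ) t =
      ((((η : UnitAddTorus (Fin N × Fin 3) → ℂ) t).re : ℝ) : ℂ) := by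
    apply Complex.ext <;> simp [him]
  generalize hr : ((η : UnitAddTorus (Fin N × Fin 3) → ℂ) t).re = r at hzre ⊢
  rw [hzre, Complex.norm_real, Real.norm_eq_abs]
  rcases le_total 0 r with h0 | h0
  · rw [max_eq_right (by linarith : -r ≤ 0), abs_of_nonneg h0]
    push_cast
    ring
  · rw [max_eq_left (by linarith : 0 ≤ -r), abs_of_nonpos h0]
    push_cast
    ring

/-- `η = η⁺ - η⁻` for a real class. [folklore] -/
theorem posPartLp_sub_negPartLp {η : L2T N} (h : conjLp η = η) : posPartLp η - negPartLp η = η := by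
  rw [posPartLp_eq_of_conjLp_eq h, negPartLp_eq_of_conjLp_eq h]
  module

/-- **Real and imaginary parts of ground states are ground states** (`E₀ < ∞`). [cite: ReedSimonIV1978, Thm XIII.43] -/
theorem reLp_mem_maxFormGroundStates (hL : 0 < L) (hv : Measurable v)
    (hW : ∫⁻ X in cellN N L, periodicInteraction v L X ≠ ⊤) (hE : periodicGroundStateEnergy v N L ≠ ⊤)
    {η : L2T N} (hη : η ∈ maxFormGroundStates v N L) : reLp η ∈ maxFormGroundStates v N L := by
  rw [reLp_eq]
  exact smul_mem_maxFormGroundStates _ (add_mem_maxFormGroundStates hL hv hW hE hη (conjLp_mem_maxFormGroundStates hη))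

/-- Imaginary parts of ground states are ground states (`E₀ < ∞`). [cite: ReedSimonIV1978, Thm XIII.43] -/
theorem imLp_mem_maxFormGroundStates (hL : 0 < L) (hv : Measurable v)
    (hW : ∫⁻ X in cellN N L, periodicInteraction v L X ≠ ⊤) (hE : periodicGroundStateEnergy v N L ≠ ⊤)
    {η : L2T N} (hη : η ∈ maxFormGroundStates v N L) : imLp η ∈ maxFormGroundStates v N L := by
  rw [imLp_eq]
  exact smul_mem_maxFormGroundStates _ (sub_mem_maxFormGroundStates hL hv hW hE hη (conjLp_mem_maxFormGroundStates hη))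

/-- **Positive parts of REAL ground states are ground states** (`E₀ < ∞`): `η⁺ = ½(|η| + η)`.
[cite: ReedSimonIV1978, Thm XIII.43 (c)⇒(a)] -/
theorem posPartLp_mem_maxFormGroundStates (hL : 0 < L) (hv : Measurable v)
    (hW : ∫⁻ X in cellN N L, periodicInteraction v L X ≠ ⊤) (hE : periodicGroundStateEnergy v N L ≠ ⊤)
    {η : L2T N} (hη : η ∈ maxFormGroundStates v N L) (hreal : conjLp η = η) :
    posPartLp η ∈ maxFormGroundStates v N L := by
  rw [posPartLp_eq_of_conjLp_eq hreal]
  exact smul_mem_maxFormGroundStates _ (add_mem_maxFormGroundStates hL hv hW hE (absLp_mem_maxFormGroundStates hη) hη)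

/-- Negative parts of REAL ground states are ground states (`E₀ < ∞`): `η⁻ = ½(|η| - η)`.
[cite: ReedSimonIV1978, Thm XIII.43 (c)⇒(a)] -/
theorem negPartLp_mem_maxFormGroundStates (hL : 0 < L) (hv : Measurable v)
    (hW : ∫⁻ X in cellN N L, periodicInteraction v L X ≠ ⊤) (hE : periodicGroundStateEnergy v N L ≠ ⊤)
    {η : L2T N} (hη : η ∈ maxFormGroundStates v N L) (hreal : conjLp η = η) :
    negPartLp η ∈ maxFormGroundStates v N L := by
  rw [negPartLp_eq_of_conjLp_eq hreal]
  exact smul_mem_maxFormGroundStates _ (sub_mem_maxFormGroundStates hL hv hW hE (absLp_mem_maxFormGroundStates hη) hη)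

/-! ### Lower semicontinuity of the maximal form along `L²`-convergent sequences -/

/-- `liminf a + liminf b ≤ liminf (a + b)` in `[0, ∞]`. [folklore] -/
theorem liminf_add_liminf_le_ennreal (a b : ℕ → ℝ≥0∞) :
    liminf a atTop + liminf b atTop ≤ liminf (fun j => a j + b j) atTop := by
  simp only [liminf_eq_iSup_iInf_of_nat]
  refine ENNReal.iSup_add_iSup_le fun i j => le_iSup_of_le (max i j) (le_iInf₂ fun k hk => ?_)
  exact add_le_add (iInf₂_le k (le_of_max_le_left hk)) (iInf₂_le k (le_of_max_le_right hk))

/-- **The kinetic part is lower semicontinuous** along `L²`-convergent sequences (each Fourier coefficient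
is continuous; Fatou for the sum). [folklore] -/
theorem maxFormKin_le_liminf (L : ℝ) {x : ℕ → L2T N} {η : L2T N} (hx : Tendsto x atTop (𝓝 η)) :
    maxFormKin L η ≤ liminf (fun j => maxFormKin L (x j)) atTop := by
  unfold maxFormKin
  rw [ENNReal.tsum_eq_iSup_sum]
  refine iSup_le fun S => ?_
  have hlim : Tendsto (fun j => ∑ n ∈ S, ENNReal.ofReal (∑ p, (2 * Real.pi * (n p : ℝ) / L) ^ 2) *
      ((‖⟪(mFourierLp 2 n : L2T N), x j⟫_ℂ‖₊ : ℝ≥0∞)) ^ 2) atTop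
      (𝓝 (∑ n ∈ S, ENNReal.ofReal (∑ p, (2 * Real.pi * (n p : ℝ) / L) ^ 2) *
        ((‖⟪(mFourierLp 2 n : L2T N), η⟫_ℂ‖₊ : ℝ≥0∞)) ^ 2)) := by
    refine tendsto_finsetSum _ fun n _ => ?_
    have hcont : Continuous fun y : L2T N => ((‖⟪(mFourierLp 2 n : L2T N), y⟫_ℂ‖₊ : ℝ≥0∞)) ^ 2 :=
      (ENNReal.continuous_pow 2).comp (ENNReal.continuous_coe.comp (continuous_const.inner continuous_id).nnnorm)
    exact ENNReal.Tendsto.const_mul ((hcont.tendsto η).comp hx) (Or.inr ENNReal.ofReal_ne_top)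
  calc ∑ n ∈ S, ENNReal.ofReal (∑ p, (2 * Real.pi * (n p : ℝ) / L) ^ 2) *
        ((‖⟪(mFourierLp 2 n : L2T N), η⟫_ℂ‖₊ : ℝ≥0∞)) ^ 2
      = liminf (fun j => ∑ n ∈ S, ENNReal.ofReal (∑ p, (2 * Real.pi * (n p : ℝ) / L) ^ 2) *
          ((‖⟪(mFourierLp 2 n : L2T N), x j⟫_ℂ‖₊ : ℝ≥0∞)) ^ 2) atTop := hlim.liminf_eq.symm
    _ ≤ _ := liminf_le_liminf (Eventually.of_forall fun j => ENNReal.sum_le_tsum S)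

/-- **The potential part is lower semicontinuous** along a.e.-convergent sequences (Fatou; the weight is
a.e. finite). [folklore] -/
theorem maxFormPot_le_liminf_of_tendsto_ae (hL : 0 < L) (hv : Measurable v)
    (hW : ∫⁻ X in cellN N L, periodicInteraction v L X ≠ ⊤) {x : ℕ → L2T N} {η : L2T N}
    (hae : ∀ᵐ t ∂(volume : Measure (UnitAddTorus (Fin N × Fin 3))),
      Tendsto (fun j => (x j : UnitAddTorus (Fin N × Fin 3) → ℂ) t) atTop
        (𝓝 ((η : UnitAddTorus (Fin N × Fin 3) → ℂ) t))) :
    maxFormPot v L η ≤ liminf (fun j => maxFormPot v L (x j)) atTop := by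
  unfold maxFormPot
  have hfin : ∀ᵐ t ∂(volume : Measure (UnitAddTorus (Fin N × Fin 3))),
      periodicInteraction v L (fromUnitTorusN L t) < ⊤ :=
    ae_lt_top (measurable_periodicInteraction_fromUnitTorusN hv L)
      (lintegral_periodicInteraction_fromUnitTorusN_ne_top hL hv hW)
  calc ∫⁻ t, periodicInteraction v L (fromUnitTorusN L t) *
        ((‖(η : UnitAddTorus (Fin N × Fin 3) → ℂ) t‖₊ : ℝ≥0∞)) ^ 2
      = ∫⁻ t, liminf (fun j => periodicInteraction v L (fromUnitTorusN L t) *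
          ((‖(x j : UnitAddTorus (Fin N × Fin 3) → ℂ) t‖₊ : ℝ≥0∞)) ^ 2) atTop := by
        refine lintegral_congr_ae ?_
        filter_upwards [hae, hfin] with t ht hWt
        have hcont : Continuous fun z : ℂ => ((‖z‖₊ : ℝ≥0∞)) ^ 2 :=
          (ENNReal.continuous_pow 2).comp (ENNReal.continuous_coe.comp continuous_nnnorm)
        exact (ENNReal.Tendsto.const_mul ((hcont.tendsto _).comp ht) (Or.inr hWt.ne)).liminf_eq.symm
    _ ≤ _ := lintegral_liminf_le' fun j => aemeasurable_pot_integrand hv L (x j)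

/-- **Lower semicontinuity of the maximal form**: if `xⱼ → η` in `L²` and `maxForm xⱼ ≤ cⱼ → C`, then
`maxForm η ≤ C` (along an a.e.-convergent subsequence). [folklore] -/
theorem maxForm_le_of_tendsto (hL : 0 < L) (hv : Measurable v)
    (hW : ∫⁻ X in cellN N L, periodicInteraction v L X ≠ ⊤) {x : ℕ → L2T N} {η : L2T N}
    (hx : Tendsto x atTop (𝓝 η)) {c : ℕ → ℝ≥0∞} {C : ℝ≥0∞} (hc : ∀ j, maxForm v L (x j) ≤ c j)
    (hC : Tendsto c atTop (𝓝 C)) : maxForm v L η ≤ C := by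
  obtain ⟨φ, hφ, hae⟩ := (tendstoInMeasure_of_tendsto_Lp hx).exists_seq_tendsto_ae
  have hx' : Tendsto (x ∘ φ) atTop (𝓝 η) := hx.comp hφ.tendsto_atTop
  have hkin := maxFormKin_le_liminf L hx'
  have hpot := maxFormPot_le_liminf_of_tendsto_ae hL hv hW (x := x ∘ φ) hae
  calc maxForm v L η = maxFormKin L η + maxFormPot v L η := rfl
    _ ≤ liminf (fun j => maxFormKin L ((x ∘ φ) j)) atTop + liminf (fun j => maxFormPot v L ((x ∘ φ) j)) atTop :=
        add_le_add hkin hpot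
    _ ≤ liminf (fun j => maxFormKin L ((x ∘ φ) j) + maxFormPot v L ((x ∘ φ) j)) atTop :=
        liminf_add_liminf_le_ennreal _ _
    _ ≤ liminf (fun j => c (φ j)) atTop := liminf_le_liminf (Eventually.of_forall fun j => hc (φ j))
    _ = C := (hC.comp hφ.tendsto_atTop).liminf_eq

/-! ### The bridge to the closed form `Q` of `PeriodicFormDomain.lean` -/

section Bridge

variable (hL : 0 < L) (hv : Measurable v) (hW : ∫⁻ X in cellN N L, periodicInteraction v L X ≠ ⊤)

/-- **Embedded core functions are Bose-symmetric in momentum space** (Bose symmetry of `Ψ` is invariance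
of `Ψ ∘ fromUnitTorusN` under the particle permutations of the torus coordinates). [folklore] -/
theorem formEmbed_graphEmbed_mem_boseSymmetric (Ψ : periodicCore N L) :
    formEmbed hL hv hW ⟨graphEmbed hL hv hW Ψ, graphEmbed_mem_formDomain hL hv hW Ψ⟩ ∈ boseSymmetric N := by
  intro σ n
  set τ : Equiv.Perm (Fin N × Fin 3) := Equiv.prodCongr σ (Equiv.refl (Fin 3)) with hτ
  have hτn : (fun i => n (τ i)) = fun p : Fin N × Fin 3 => n (σ p.1, p.2) := comp_prodCongr_eq σ n
  set f : L2T N := formEmbed hL hv hW ⟨graphEmbed hL hv hW Ψ, graphEmbed_mem_formDomain hL hv hW Ψ⟩ with hf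
  have hfc := coeFn_formEmbed_graphEmbed hL hv hW Ψ
  have hF : ∀ t : UnitAddTorus (Fin N × Fin 3),
      (cellScale N L : ℂ) * (Ψ : Config N → ℂ) (fromUnitTorusN L (fun i => t (τ i))) =
        (cellScale N L : ℂ) * (Ψ : Config N → ℂ) (fromUnitTorusN L t) := by
    intro t
    have hperm : fromUnitTorusN L (fun i => t (τ i)) = (fromUnitTorusN L t) ∘ σ := by
      funext i
      rfl
    rw [hperm, Ψ.2.2.2 σ]
  have hfcT : ∀ᵐ t ∂(volume : Measure (UnitAddTorus (Fin N × Fin 3))),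
      (f : UnitAddTorus (Fin N × Fin 3) → ℂ) (fun i => t (τ i)) =
        (cellScale N L : ℂ) * (Ψ : Config N → ℂ) (fromUnitTorusN L (fun i => t (τ i))) := by
    have h := (measurePreserving_compPerm (D := Fin N × Fin 3) τ).quasiMeasurePreserving.ae_eq_comp hfc
    filter_upwards [h] with t ht
    simpa only [Function.comp_apply, compPerm_apply] using ht
  have hfae : ∀ᵐ t ∂(volume : Measure (UnitAddTorus (Fin N × Fin 3))),
      (f : UnitAddTorus (Fin N × Fin 3) → ℂ) (fun i => t (τ i)) = (f : UnitAddTorus (Fin N × Fin 3) → ℂ) t := by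
    filter_upwards [hfc, hfcT] with t h1 h2
    rw [h2, hF, h1]
  rw [← hτn]
  exact inner_symm_of_ae_eq_comp_perm f τ hfae n

/-- The embedded core functions converge to the embedded limit. [folklore] -/
theorem tendsto_formEmbed_graphEmbed {Ψ : ℕ → periodicCore N L} {u : formDomain hL hv hW}
    (hΨ : Tendsto (fun j => graphEmbed hL hv hW (Ψ j)) atTop (𝓝 (u : PiLp 2 (fun _ : CompIdx N => L2T N)))) :
    Tendsto (fun j => formEmbed hL hv hW ⟨graphEmbed hL hv hW (Ψ j), graphEmbed_mem_formDomain hL hv hW (Ψ j)⟩)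
      atTop (𝓝 (formEmbed hL hv hW u)) := by
  change Tendsto (fun j => (PiLp.proj 2 (𝕜 := ℂ) (fun _ : CompIdx N => L2T N) (Sum.inl ())) (graphEmbed hL hv hW (Ψ j)))
    atTop (𝓝 ((PiLp.proj 2 (𝕜 := ℂ) (fun _ : CompIdx N => L2T N) (Sum.inl ())) (u : PiLp 2 (fun _ : CompIdx N => L2T N))))
  exact ((PiLp.proj 2 (𝕜 := ℂ) (fun _ : CompIdx N => L2T N) (Sum.inl ())).continuous.tendsto _).comp hΨ

/-- **Every class of the form domain is Bose-symmetric in momentum space** (the Bose sector is closed).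
[folklore] -/
theorem formEmbed_mem_boseSymmetric (u : formDomain hL hv hW) : formEmbed hL hv hW u ∈ boseSymmetric N := by
  obtain ⟨Ψ, hΨ⟩ := exists_seq_tendsto_of_mem_formDomain hL hv hW u
  exact isClosed_boseSymmetric.mem_of_tendsto (tendsto_formEmbed_graphEmbed hL hv hW hΨ)
    (Eventually.of_forall fun j => formEmbed_graphEmbed_mem_boseSymmetric hL hv hW (Ψ j))

/-- **The maximal form of an embedded core function is its energy integral**
`∫_{[0,L)^{3N}} |∇Ψ|² + W|Ψ|²`. [cite: Simon1979Forms, Thm. 2.1] -/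
theorem maxForm_formEmbed_graphEmbed (Ψ : periodicCore N L) :
    maxForm v L (formEmbed hL hv hW ⟨graphEmbed hL hv hW Ψ, graphEmbed_mem_formDomain hL hv hW Ψ⟩) =
      ∫⁻ X in cellN N L, kineticDensity (Ψ : Config N → ℂ) X +
        periodicInteraction v L X * ((‖(Ψ : Config N → ℂ) X‖₊ : ℝ≥0∞)) ^ 2 := by
  rw [maxForm, maxFormKin, maxFormPot, tsum_kinetic_formEmbed_graphEmbed hL hv hW Ψ,
    lintegral_pot_formEmbed_graphEmbed hL hv hW Ψ (measurable_periodicInteraction_gs hv L),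
    ← lintegral_add_left (measurable_kineticDensity_any _)]

/-- For a core function, `maxForm (ιΨ) = ‖graphEmbed Ψ‖² - ‖ιΨ‖²` (finite). [cite: Simon1979Forms, Thm. 2.1] -/
theorem maxForm_formEmbed_graphEmbed_eq_ofReal (Ψ : periodicCore N L) :
    maxForm v L (formEmbed hL hv hW ⟨graphEmbed hL hv hW Ψ, graphEmbed_mem_formDomain hL hv hW Ψ⟩) =
      ENNReal.ofReal (‖graphEmbed hL hv hW Ψ‖ ^ 2 -
        ‖formEmbed hL hv hW ⟨graphEmbed hL hv hW Ψ, graphEmbed_mem_formDomain hL hv hW Ψ⟩‖ ^ 2) := by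
  rw [maxForm_formEmbed_graphEmbed, norm_graphEmbed_sq hL hv hW Ψ, norm_formEmbed_graphEmbed_sq hL hv hW Ψ,
    add_sub_cancel_left, ENNReal.ofReal_toReal (lintegral_energy_lt_top hv hW Ψ.2.1).ne]

/-- **The maximal form is dominated by the closed form on the form domain**:
`maxForm (ι u) ≤ ‖u‖²_Q - ‖ι u‖²` for every `u ∈ Q` (lower semicontinuity along core approximants; in fact
an equality, Simon's "maximal form = minimal form", not needed here). [cite: Simon1979Forms, Thm. 2.1] -/
theorem maxForm_formEmbed_le (u : formDomain hL hv hW) :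
    maxForm v L (formEmbed hL hv hW u) ≤ ENNReal.ofReal (‖u‖ ^ 2 - ‖formEmbed hL hv hW u‖ ^ 2) := by
  obtain ⟨Ψ, hΨ⟩ := exists_seq_tendsto_of_mem_formDomain hL hv hW u
  have hx := tendsto_formEmbed_graphEmbed hL hv hW hΨ
  have hnormQ : Tendsto (fun j => ‖graphEmbed hL hv hW (Ψ j)‖) atTop (𝓝 ‖u‖) :=
    (continuous_norm.tendsto _).comp hΨ
  have hnormH : Tendsto (fun j => ‖formEmbed hL hv hW ⟨graphEmbed hL hv hW (Ψ j),
      graphEmbed_mem_formDomain hL hv hW (Ψ j)⟩‖) atTop (𝓝 ‖formEmbed hL hv hW u‖) :=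
    (continuous_norm.tendsto _).comp hx
  refine maxForm_le_of_tendsto hL hv hW hx
    (c := fun j => ENNReal.ofReal (‖graphEmbed hL hv hW (Ψ j)‖ ^ 2 -
      ‖formEmbed hL hv hW ⟨graphEmbed hL hv hW (Ψ j), graphEmbed_mem_formDomain hL hv hW (Ψ j)⟩‖ ^ 2))
    (fun j => (maxForm_formEmbed_graphEmbed_eq_ofReal hL hv hW (Ψ j)).le) ?_
  exact (ENNReal.continuous_ofReal.tendsto _).comp ((hnormQ.pow 2).sub (hnormH.pow 2))

/-- **Bridge: variational ground states are ground states of the maximal form.** If `u ∈ Q` is an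
eigenvector of the Gram operator `ι†ι` of the form embedding for its top eigenvalue `κ₁`
(`periodicGroundStateEnergy v N L = κ₁⁻¹ - 1`, `PeriodicFormSpectrum.lean`), then `ι u` lies in
`maxFormGroundStates v N L`. [cite: ReedSimonIV1978, Thm. XIII.1 and XIII.64] -/
theorem formEmbed_mem_maxFormGroundStates_of_gramOp_eq (d : TwoModeData (formEmbed hL hv hW))
    {u : formDomain hL hv hW} (hu : gramOp (formEmbed hL hv hW) u = (d.κ₁ : ℂ) • u) :
    formEmbed hL hv hW u ∈ maxFormGroundStates v N L := by
  refine ⟨formEmbed_mem_boseSymmetric hL hv hW u, ?_⟩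
  have h1 := maxForm_formEmbed_le hL hv hW u
  have h2 : ‖formEmbed hL hv hW u‖ ^ 2 = d.κ₁ * ‖u‖ ^ 2 := norm_map_sq_of_gramOp_eq_smul (formEmbed hL hv hW) hu
  have hκ := d.κ₁_pos
  rw [periodicGroundStateEnergy_eq_ofReal d,
    ← ENNReal.ofReal_mul (by linarith [twoModeData_one_le_inv_κ₁ d] : 0 ≤ d.κ₁⁻¹ - 1)]
  refine h1.trans (le_of_eq ?_)
  congr 1
  rw [h2]
  field_simp

end Bridge

end Literature.MathematicalPhysics.QuantumManyBody.BoseGas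

end
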